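import Mathlib.Algebra.MvPolynomial.PDeriv
import Mathlib.RingTheory.Ideal.Operations
import HarnessLib

/-!
# [OURS · L1 W4.5(b) · EL♮(3) · residue-2, brick D3] Specimen Jacobian facts

Crux chain w45b (cell `res-hironaka`), child EL♮(3) = stmt-ResolutionOfSingularities-20148, residue
`stub_elnat_three_nonisolated_nonRatNoseTower`; brick D3 of res-L1-w45b-stub-4 g9's RESIDUE-2 census (`L/res-L1-w45b-stub-4/RESIDUE2-CENSUS.md`
598f05d6100306f2, sigs `RESIDUE2-pieces.sig.lean` 1b9598fbe85947fc l.60–68, verbatim): the two ring facts behind the (R2-a) specimen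
`F = G² + x₀³ C` («cusp × plane cubic»): `F ∈ (x₀, G)²` (`sq_add_cube_mul_mem_sq`), and the Leibniz fact that every partial derivative of an
element of `J²` lies in `J` (`pderiv_mem_of_mem_sq`), so `V(J) ⊆ Sing V(F)`. Written by res-L1-w45b-stub-3 g7. OURS; NOT a statement of any
manuscript; AI-written, weaker than expert review. No `sorry`; standard axioms; DEF-FREE. `--supports stmt-ResolutionOfSingularities-20148 --as helper`.
-/

set_option linter.dupNamespace false -- mandated namespace `Summit.<Summit>.<Problem>` of this single-conjunct summit

noncomputable section

namespace Summit.ResolutionOfSingularities.ResolutionOfSingularities.Cruxes.EquisingularLiftNat.Sections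

/-- **D3a — the (R2-a) specimen polynomial lies in the square of the nose ideal**: `G² + x₀³ C ∈ (x₀, G)²`. [OURS] -/
theorem sq_add_cube_mul_mem_sq {k : Type} [CommRing k] (G C : MvPolynomial (Fin 4) k) :
    G ^ 2 + MvPolynomial.X 0 ^ 3 * C ∈ (Ideal.span {MvPolynomial.X 0, G} : Ideal (MvPolynomial (Fin 4) k)) ^ 2 := by
  set J : Ideal (MvPolynomial (Fin 4) k) := Ideal.span {MvPolynomial.X 0, G} with hJ
  have hx : (MvPolynomial.X 0 : MvPolynomial (Fin 4) k) ∈ J := Ideal.subset_span (Set.mem_insert _ _)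
  have hG : G ∈ J := Ideal.subset_span (Set.mem_insert_of_mem _ rfl)
  refine Ideal.add_mem _ ?_ ?_
  · rw [pow_two, pow_two]
    exact Ideal.mul_mem_mul hG hG
  · have h : MvPolynomial.X 0 ^ 3 * C = (MvPolynomial.X 0 * MvPolynomial.X 0) * (MvPolynomial.X 0 * C) := by ring
    rw [h, pow_two]
    exact Ideal.mul_mem_mul (Ideal.mul_mem_right _ _ hx) (Ideal.mul_mem_right _ _ hx)

/-- **D3b — partial derivatives of an element of `J²` lie in `J`** (Leibniz: `∂(ab) = (∂a) b + a (∂b)`); hence `V(J) ⊆ Sing V(F)` for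
`F ∈ J²`. [OURS] -/
theorem pderiv_mem_of_mem_sq {k : Type} [CommRing k] {n : ℕ} (J : Ideal (MvPolynomial (Fin n) k)) (F : MvPolynomial (Fin n) k)
    (hF : F ∈ J ^ 2) (i : Fin n) : MvPolynomial.pderiv i F ∈ J := by
  rw [pow_two] at hF
  refine Submodule.mul_induction_on hF (fun a ha b hb => ?_) (fun a b ha hb => ?_)
  · rw [(MvPolynomial.pderiv i).leibniz a b, smul_eq_mul, smul_eq_mul]
    exact Ideal.add_mem _ (Ideal.mul_mem_right _ _ ha) (Ideal.mul_mem_right _ _ hb)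
  · rw [map_add]
    exact Ideal.add_mem _ ha hb

end Summit.ResolutionOfSingularities.ResolutionOfSingularities.Cruxes.EquisingularLiftNat.Sections

end
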